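import Mathlib
import Summits.HodgeConjecture.HodgeConjecture.Theorems.WeilClassTestFormatFiveThreeVertexGauge

/-!
# Conjecture N (hodge-weil ladder, GAPS G51b), format (5,3): CROSS + ONE FREE ROOT — the gauge value of `G`

Prover 2, generation 22 (note `run/shared/lean/b2b/hodge-weil/b2b-hweil-pv2-g22/CROSSPLUS1-G22.md`). Generation 21's `G_on_cross_53`
(`WeilClassTestFormatFiveThreeVertexGauge`) evaluates `G = Q₂ + Q₄` on a cross from the vertex-gauge identities; the same linear combination with
ONE root off the cross — `(A₁ − As)² = (u₁ − us)² + 4e` instead of equality, `e = x₁·y₁` the product of that root's corner distances — gives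
**`G_gauge_cross_plus_one`**: `Q₂ + Q₄ = Mo² + (S/2)T² − S² − 2S·us² − 4e·(3(u₁² − S/2) + S)` (centred, `P2 = P4 = 0`; P1 not used here).
Pure algebra; no case of HC, no rung; no statement of Markman's papers is used. New cell result ⇒ Summits/.
-/

set_option linter.dupNamespace false
set_option maxRecDepth 16384

namespace Summit.HodgeConjecture.HodgeConjecture.WeilClassTestFormatFiveThreeCrossPlusOneGauge


set_option maxHeartbeats 4000000 in
/-- `G = Q₂ + Q₄` when every root EXCEPT E₁ lies on the cross through `(As, us)` (`(A_k − As)² = (u_k − us)²` for `k ≠ 1`,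
`(A₁ − As)² = (u₁ − us)² + 4e`, `e = x₁y₁` the product of E₁'s corner distances), centred with `P2 = 0`, `P4 = 0`:
`Q₂ + Q₄ = Mo² + (S/2)·T² − S² − 2·S·us² − 4e·(3(u₁² − S/2) + S)` — generation 21's `G_on_cross_53` plus the one-root correction
(same linear combination of the gauge identities). -/
theorem G_gauge_cross_plus_one (A₁ A₂ A₃ A₄ A₅ B₁ B₂ B₃ u₁ u₂ u₃ u₄ u₅ v₁ v₂ v₃ As us e : ℝ)
    (hA : A₁ + A₂ + A₃ + A₄ + A₅ = B₁ + B₂ + B₃) (hC : u₁ + u₂ + u₃ + u₄ + u₅ = v₁ + v₂ + v₃)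
    (hP2 : ((A₁ * u₁ ^ 2 + A₂ * u₂ ^ 2 + A₃ * u₃ ^ 2 + A₄ * u₄ ^ 2 + A₅ * u₅ ^ 2) - (B₁ * v₁ ^ 2 + B₂ * v₂ ^ 2 + B₃ * v₃ ^ 2)) = 0)
    (hP4 : ((u₁ ^ 3 + u₂ ^ 3 + u₃ ^ 3 + u₄ ^ 3 + u₅ ^ 3) - (v₁ ^ 3 + v₂ ^ 3 + v₃ ^ 3)) = 0)
    (hX₁ : (A₁ - As) ^ 2 = (u₁ - us) ^ 2 + 4 * e) (hX₂ : (A₂ - As) ^ 2 = (u₂ - us) ^ 2) (hX₃ : (A₃ - As) ^ 2 = (u₃ - us) ^ 2) (hX₄ : (A₄ - As) ^ 2 = (u₄ - us) ^ 2) (hX₅ : (A₅ - As) ^ 2 = (u₅ - us) ^ 2) (hY₁ : (As - B₁) ^ 2 = (v₁ - us) ^ 2) (hY₂ : (As - B₂) ^ 2 = (v₂ - us) ^ 2) (hY₃ : (As - B₃) ^ 2 = (v₃ - us) ^ 2) :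
    (1 / 2) * ((A₁ ^ 2 + A₂ ^ 2 + A₃ ^ 2 + A₄ ^ 2 + A₅ ^ 2) - (B₁ ^ 2 + B₂ ^ 2 + B₃ ^ 2)) * ((u₁ ^ 2 + u₂ ^ 2 + u₃ ^ 2 + u₄ ^ 2 + u₅ ^ 2) - (v₁ ^ 2 + v₂ ^ 2 + v₃ ^ 2))
        + ((A₁ * u₁ + A₂ * u₂ + A₃ * u₃ + A₄ * u₄ + A₅ * u₅) - (B₁ * v₁ + B₂ * v₂ + B₃ * v₃)) ^ 2
        - 3 * ((A₁ ^ 2 * u₁ ^ 2 + A₂ ^ 2 * u₂ ^ 2 + A₃ ^ 2 * u₃ ^ 2 + A₄ ^ 2 * u₄ ^ 2 + A₅ ^ 2 * u₅ ^ 2) - (B₁ ^ 2 * v₁ ^ 2 + B₂ ^ 2 * v₂ ^ 2 + B₃ ^ 2 * v₃ ^ 2))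
      + (3 * ((u₁ ^ 4 + u₂ ^ 4 + u₃ ^ 4 + u₄ ^ 4 + u₅ ^ 4) - (v₁ ^ 4 + v₂ ^ 4 + v₃ ^ 4)) - (3 / 2) * ((u₁ ^ 2 + u₂ ^ 2 + u₃ ^ 2 + u₄ ^ 2 + u₅ ^ 2) - (v₁ ^ 2 + v₂ ^ 2 + v₃ ^ 2)) ^ 2)
      = (u₁ * (A₁ - As) + u₂ * (A₂ - As) + u₃ * (A₃ - As) + u₄ * (A₄ - As) + u₅ * (A₅ - As) + v₁ * (As - B₁) + v₂ * (As - B₂) + v₃ * (As - B₃)) ^ 2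
        + (((u₁ ^ 2 + u₂ ^ 2 + u₃ ^ 2 + u₄ ^ 2 + u₅ ^ 2) - (v₁ ^ 2 + v₂ ^ 2 + v₃ ^ 2)) / 2) * ((A₁ - As) + (A₂ - As) + (A₃ - As) + (A₄ - As) + (A₅ - As) + (As - B₁) + (As - B₂) + (As - B₃)) ^ 2
        - ((u₁ ^ 2 + u₂ ^ 2 + u₃ ^ 2 + u₄ ^ 2 + u₅ ^ 2) - (v₁ ^ 2 + v₂ ^ 2 + v₃ ^ 2)) ^ 2 - 2 * ((u₁ ^ 2 + u₂ ^ 2 + u₃ ^ 2 + u₄ ^ 2 + u₅ ^ 2) - (v₁ ^ 2 + v₂ ^ 2 + v₃ ^ 2)) * us ^ 2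
        - 4 * e * (3 * (u₁ ^ 2 - ((u₁ ^ 2 + u₂ ^ 2 + u₃ ^ 2 + u₄ ^ 2 + u₅ ^ 2) - (v₁ ^ 2 + v₂ ^ 2 + v₃ ^ 2)) / 2) + ((u₁ ^ 2 + u₂ ^ 2 + u₃ ^ 2 + u₄ ^ 2 + u₅ ^ 2) - (v₁ ^ 2 + v₂ ^ 2 + v₃ ^ 2))) := by
  linear_combination ((((u₁ ^ 2 + u₂ ^ 2 + u₃ ^ 2 + u₄ ^ 2 + u₅ ^ 2) - (v₁ ^ 2 + v₂ ^ 2 + v₃ ^ 2)) * ((A₁ + A₂ + A₃ + A₄ + A₅) - (B₁ + B₂ + B₃)) - 3 * ((A₁ * u₁ ^ 2 + A₂ * u₂ ^ 2 + A₃ * u₃ ^ 2 + A₄ * u₄ ^ 2 + A₅ * u₅ ^ 2) - (B₁ * v₁ ^ 2 + B₂ * v₂ ^ 2 + B₃ * v₃ ^ 2))) - 3 * ((A₁ - As) + (A₂ - As) + (A₃ - As) + (A₄ - As) + (A₅ - As) + (As - B₁) + (As - B₂) + (As - B₃)) * (((u₁ ^ 2 + u₂ ^ 2 + u₃ ^ 2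 + u₄ ^ 2 + u₅ ^ 2) - (v₁ ^ 2 + v₂ ^ 2 + v₃ ^ 2)) / 2)) * hA + ((2 * As * ((A₁ * u₁ + A₂ * u₂ + A₃ * u₃ + A₄ * u₄ + A₅ * u₅) - (B₁ * v₁ + B₂ * v₂ + B₃ * v₃)) - As ^ 2 * ((u₁ + u₂ + u₃ + u₄ + u₅) - (v₁ + v₂ + v₃))) - (us * ((u₁ ^ 2 + u₂ ^ 2 + u₃ ^ 2 + u₄ ^ 2 + u₅ ^ 2) - (v₁ ^ 2 + v₂ ^ 2 + v₃ ^ 2)))) * hC + (3 * ((A₁ - As) + (A₂ - As) + (A₃ - As) + (A₄ - As) + (A₅ - As) + (As - B₁) + (As - B₂) + (As - B₃))) * hP2 + (6 * us) * hP4 + (-(3 * (u₁ ^ 2 - ((u₁ ^ 2 + u₂ ^ 2 + u₃ ^ 2 + u₄ ^ 2 + u₅ ^ 2) - (v₁ ^ 2 + v₂ ^ 2 + v₃ ^ 2)) / 2) + ((u₁ ^ 2 + u₂ ^ 2 + u₃ ^ 2 + u₄ ^ 2 + u₅ ^ 2) - (v₁ ^ 2 + v₂ ^ 2 + v₃ ^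 2)))) * hX₁ + (-(3 * (u₂ ^ 2 - ((u₁ ^ 2 + u₂ ^ 2 + u₃ ^ 2 + u₄ ^ 2 + u₅ ^ 2) - (v₁ ^ 2 + v₂ ^ 2 + v₃ ^ 2)) / 2) + ((u₁ ^ 2 + u₂ ^ 2 + u₃ ^ 2 + u₄ ^ 2 + u₅ ^ 2) - (v₁ ^ 2 + v₂ ^ 2 + v₃ ^ 2)))) * hX₂ + (-(3 * (u₃ ^ 2 - ((u₁ ^ 2 + u₂ ^ 2 + u₃ ^ 2 + u₄ ^ 2 + u₅ ^ 2) - (v₁ ^ 2 + v₂ ^ 2 + v₃ ^ 2)) / 2) + ((u₁ ^ 2 + u₂ ^ 2 + u₃ ^ 2 + u₄ ^ 2 + u₅ ^ 2) - (v₁ ^ 2 + v₂ ^ 2 + v₃ ^ 2)))) * hX₃ + (-(3 * (u₄ ^ 2 - ((u₁ ^ 2 + u₂ ^ 2 + u₃ ^ 2 + u₄ ^ 2 + u₅ ^ 2) - (v₁ ^ 2 + v₂ ^ 2 + v₃ ^ 2)) / 2) + ((u₁ ^ 2 + u₂ ^ 2 + u₃ ^ 2 + u₄ ^ 2 + u₅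 ^ 2) - (v₁ ^ 2 + v₂ ^ 2 + v₃ ^ 2)))) * hX₄ + (-(3 * (u₅ ^ 2 - ((u₁ ^ 2 + u₂ ^ 2 + u₃ ^ 2 + u₄ ^ 2 + u₅ ^ 2) - (v₁ ^ 2 + v₂ ^ 2 + v₃ ^ 2)) / 2) + ((u₁ ^ 2 + u₂ ^ 2 + u₃ ^ 2 + u₄ ^ 2 + u₅ ^ 2) - (v₁ ^ 2 + v₂ ^ 2 + v₃ ^ 2)))) * hX₅ + (3 * (v₁ ^ 2 - ((u₁ ^ 2 + u₂ ^ 2 + u₃ ^ 2 + u₄ ^ 2 + u₅ ^ 2) - (v₁ ^ 2 + v₂ ^ 2 + v₃ ^ 2)) / 2) + ((u₁ ^ 2 + u₂ ^ 2 + u₃ ^ 2 + u₄ ^ 2 + u₅ ^ 2) - (v₁ ^ 2 + v₂ ^ 2 + v₃ ^ 2))) * hY₁ + (3 * (v₂ ^ 2 - ((u₁ ^ 2 + u₂ ^ 2 + u₃ ^ 2 + u₄ ^ 2 + u₅ ^ 2) - (v₁ ^ 2 + v₂ ^ 2 + v₃ ^ 2)) / 2) + ((u₁ ^ 2 + u₂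 ^ 2 + u₃ ^ 2 + u₄ ^ 2 + u₅ ^ 2) - (v₁ ^ 2 + v₂ ^ 2 + v₃ ^ 2))) * hY₂ + (3 * (v₃ ^ 2 - ((u₁ ^ 2 + u₂ ^ 2 + u₃ ^ 2 + u₄ ^ 2 + u₅ ^ 2) - (v₁ ^ 2 + v₂ ^ 2 + v₃ ^ 2)) / 2) + ((u₁ ^ 2 + u₂ ^ 2 + u₃ ^ 2 + u₄ ^ 2 + u₅ ^ 2) - (v₁ ^ 2 + v₂ ^ 2 + v₃ ^ 2))) * hY₃

end Summit.HodgeConjecture.HodgeConjecture.WeilClassTestFormatFiveThreeCrossPlusOneGauge
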